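import Literature.NumberTheory.LFunctions.FeketePolyaKernelCertificatesBlockWrappers
import HarnessLib

/-!
# No real zero for real primitive characters of conductor `10068 ≤ q ≤ 10747`: the Fekete–Pólya rows, in the kernel (rows deferred by the earlier engines)

Topic `Literature/NumberTheory/LFunctions`; namespace `Literature.NumberTheory.LFunctions`. THEOREMS only (no
definition, no named fact, no `sorry`; standard axioms): one PUBLIC theorem **`noRealZero{Odd,Even}_fp_<q>`** per
fundamental discriminant `D`, `|D| = q ∈ [10068, 10747]`, that admits a Fekete–Pólya witness but was DEFERRED by the per-position engines v1/v2 (walk too long for one `decide`) — for every primitive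
quadratic `χ` mod `q` of the parity of `D` and every `σ ∈ (0, 1)`, `L(σ, χ) ≠ 0` (statement shape of the
`interval_cases` bullets of the `NoRealZero{Odd,Even}…` range files, so a range assembly cites them by name).
Cell `parity-realchar`, kernel floor of the wide column (TARGET §2 row 19), Fekete–Pólya lane (seat prover-2).

Method (engine v4): `FeketePolyaKernelCertificatesBlock{,Wrappers}.lean` — the iterated partial sums of order
`K` of the induced character `χ↑(q·w)` are non-negative over one period, decided in the kernel BLOCKWISE on packed
base-`2^b` digits (`blockCert b B K (q·w) (tabs… b ps q w)`: sign tables of the character from the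
quadratic-residue bitsets of the prime factors of the conductor — the factor list is part of each certificate,
primality by `norm_num` — prefix sums by one big-integer multiplication per order and block, sign test by one
AND), hence `ℜL(σ, χ↑(q·w)) > 0` (Fekete–Pólya 1912 / MV §11.2.1 Exercise 7) and `L(σ, χ) ≠ 0` (positive Euler
factors, Exercise 8).  Witnesses `(w, K)` = the cheapest in the exact integer scan of this seat
(`HOME/parity-realchar-prover-2/fp-witnesses-*.tsv`; no kit); the digit width `b` is two bits above the size of
the running-sum bound recorded by the scan.  13 characters in this file (est. 77 kernel-s).
NOT covered here (no Fekete–Pólya witness with `w ≤ 40`, `q·w ≤ 4·10⁵`, `K ≤ 12`; the other Fekete–Pólya rows of this range are in the `NoRealZeroFeketePolyaX…` files) — left to the truncation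
certificates of the companion lane: see those files.

## References

* H. L. Montgomery, R. C. Vaughan, *Multiplicative Number Theory I*, CUP 2007, §9.3 Thm 9.13, §11.2.1
  Exercises 7–8. [MontgomeryVaughan2007]
* M. Fekete, G. Pólya, *Über ein Problem von Laguerre*, Rend. Circ. Mat. Palermo 34 (1912) 89–120. [FeketePolya1912]
-/

namespace Literature.NumberTheory.LFunctions

open FeketePolyaKernel

set_option maxHeartbeats 400000 in
/-- `D = -10068`: the odd character `χ₋₄·(·/2517)` of conductor `10068` (`2517`: 3 · 839) — Fekete–Pólya witness of order `2` along the induced modulus `10068·35 = 352380`, block certificate (digits of `28` bits, splitting depth `9`); est. `1.6` kernel-s. [cite: MontgomeryVaughan2007, §11.2.1 Exercises 7 (g), 8] -/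
theorem noRealZeroOdd_fp_10068 :
    ∀ χ : DirichletCharacter ℂ 10068, χ.IsQuadratic → χ.IsPrimitive → χ.Odd →
      ∀ σ : ℝ, 0 < σ → σ < 1 → χ.LFunction σ ≠ 0 :=
  good_odd_of_four_blk [3, 839] (by norm_num) (by decide) (by decide) 35 2 28 9 (by decide) (by decide) (by decide)
    (Or.inr (by decide +kernel))

set_option maxHeartbeats 400000 in
/-- `D = 10133`: the even character `(·/10133)` of conductor `10133` (`10133`: prime) — Fekete–Pólya witness of order `5` along the induced modulus `10133·30 = 303990`, block certificate (digits of `76` bits, splitting depth `11`); est. `7.8` kernel-s. [cite: MontgomeryVaughan2007, §11.2.1 Exercises 7 (g), 8] -/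
theorem noRealZeroEven_fp_10133 :
    ∀ χ : DirichletCharacter ℂ 10133, χ.IsQuadratic → χ.IsPrimitive → χ.Even →
      ∀ σ : ℝ, 0 < σ → σ < 1 → χ.LFunction σ ≠ 0 :=
  good_even_of_odd_blk [10133] (by norm_num) (by decide) (by decide) 30 5 76 11 (by decide) (by decide) (by decide)
    (Or.inr (by decide +kernel))

set_option maxHeartbeats 400000 in
/-- `D = 10220`: the even character `χ₋₄·(·/2555)` of conductor `10220` (`2555`: 5 · 7 · 73) — Fekete–Pólya witness of order `3` along the induced modulus `10220·39 = 398580`, block certificate (digits of `42` bits, splitting depth `10`); est. `3.7` kernel-s. [cite: MontgomeryVaughan2007, §11.2.1 Exercises 7 (g), 8] -/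
theorem noRealZeroEven_fp_10220 :
    ∀ χ : DirichletCharacter ℂ 10220, χ.IsQuadratic → χ.IsPrimitive → χ.Even →
      ∀ σ : ℝ, 0 < σ → σ < 1 → χ.LFunction σ ≠ 0 :=
  good_even_of_four_blk [5, 7, 73] (by norm_num) (by decide) (by decide) 39 3 42 10 (by decide) (by decide) (by decide)
    (Or.inr (by decide +kernel))

set_option maxHeartbeats 400000 in
/-- `D = -10228`: the odd character `χ₋₄·(·/2557)` of conductor `10228` (`2557`: prime) — Fekete–Pólya witness of order `6` along the induced modulus `10228·35 = 357980`, block certificate (digits of `94` bits, splitting depth `11`); est. `10.8` kernel-s. [cite: MontgomeryVaughan2007, §11.2.1 Exercises 7 (g), 8] -/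
theorem noRealZeroOdd_fp_10228 :
    ∀ χ : DirichletCharacter ℂ 10228, χ.IsQuadratic → χ.IsPrimitive → χ.Odd →
      ∀ σ : ℝ, 0 < σ → σ < 1 → χ.LFunction σ ≠ 0 :=
  good_odd_of_four_blk [2557] (by norm_num) (by decide) (by decide) 35 6 94 11 (by decide) (by decide) (by decide)
    (Or.inr (by decide +kernel))

set_option maxHeartbeats 400000 in
/-- `D = 10229`: the even character `(·/10229)` of conductor `10229` (`10229`: 53 · 193) — Fekete–Pólya witness of order `7` along the induced modulus `10229·22 = 225038`, block certificate (digits of `104` bits, splitting depth `10`); est. `8.1` kernel-s. [cite: MontgomeryVaughan2007, §11.2.1 Exercises 7 (g), 8] -/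
theorem noRealZeroEven_fp_10229 :
    ∀ χ : DirichletCharacter ℂ 10229, χ.IsQuadratic → χ.IsPrimitive → χ.Even →
      ∀ σ : ℝ, 0 < σ → σ < 1 → χ.LFunction σ ≠ 0 :=
  good_even_of_odd_blk [53, 193] (by norm_num) (by decide) (by decide) 22 7 104 10 (by decide) (by decide) (by decide)
    (Or.inr (by decide +kernel))

set_option maxHeartbeats 400000 in
/-- `D = 10265`: the even character `(·/10265)` of conductor `10265` (`10265`: 5 · 2053) — Fekete–Pólya witness of order `6` along the induced modulus `10265·17 = 174505`, block certificate (digits of `87` bits, splitting depth `10`); est. `5.2` kernel-s. [cite: MontgomeryVaughan2007, §11.2.1 Exercises 7 (g), 8] -/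
theorem noRealZeroEven_fp_10265 :
    ∀ χ : DirichletCharacter ℂ 10265, χ.IsQuadratic → χ.IsPrimitive → χ.Even →
      ∀ σ : ℝ, 0 < σ → σ < 1 → χ.LFunction σ ≠ 0 :=
  good_even_of_odd_blk [5, 2053] (by norm_num) (by decide) (by decide) 17 6 87 10 (by decide) (by decide) (by decide)
    (Or.inr (by decide +kernel))

set_option maxHeartbeats 400000 in
/-- `D = 10280`: the even character `χ₈·(·/1285)` of conductor `10280` (`1285`: 5 · 257) — Fekete–Pólya witness of order `2` along the induced modulus `10280·33 = 339240`, block certificate (digits of `25` bits, splitting depth `9`); est. `1.4` kernel-s. [cite: MontgomeryVaughan2007, §11.2.1 Exercises 7 (g), 8] -/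
theorem noRealZeroEven_fp_10280 :
    ∀ χ : DirichletCharacter ℂ 10280, χ.IsQuadratic → χ.IsPrimitive → χ.Even →
      ∀ σ : ℝ, 0 < σ → σ < 1 → χ.LFunction σ ≠ 0 :=
  good_even_of_eight_blk [5, 257] (by norm_num) (by decide) (by decide) 33 2 25 9 (by decide) (by decide) (by decide)
    (Or.inl (by decide +kernel)) (Or.inr (by decide +kernel))

set_option maxHeartbeats 400000 in
/-- `D = -10363`: the odd character `(·/10363)` of conductor `10363` (`10363`: 43 · 241) — Fekete–Pólya witness of order `8` along the induced modulus `10363·15 = 155445`, block certificate (digits of `116` bits, splitting depth `10`); est. `6.7` kernel-s. [cite: MontgomeryVaughan2007, §11.2.1 Exercises 7 (g), 8] -/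
theorem noRealZeroOdd_fp_10363 :
    ∀ χ : DirichletCharacter ℂ 10363, χ.IsQuadratic → χ.IsPrimitive → χ.Odd →
      ∀ σ : ℝ, 0 < σ → σ < 1 → χ.LFunction σ ≠ 0 :=
  good_odd_of_odd_blk [43, 241] (by norm_num) (by decide) (by decide) 15 8 116 10 (by decide) (by decide) (by decide)
    (Or.inr (by decide +kernel))

set_option maxHeartbeats 400000 in
/-- `D = 10373`: the even character `(·/10373)` of conductor `10373` (`10373`: 11 · 23 · 41) — Fekete–Pólya witness of order `5` along the induced modulus `10373·30 = 311190`, block certificate (digits of `76` bits, splitting depth `11`); est. `7.4` kernel-s. [cite: MontgomeryVaughan2007, §11.2.1 Exercises 7 (g), 8] -/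
theorem noRealZeroEven_fp_10373 :
    ∀ χ : DirichletCharacter ℂ 10373, χ.IsQuadratic → χ.IsPrimitive → χ.Even →
      ∀ σ : ℝ, 0 < σ → σ < 1 → χ.LFunction σ ≠ 0 :=
  good_even_of_odd_blk [11, 23, 41] (by norm_num) (by decide) (by decide) 30 5 76 11 (by decide) (by decide) (by decide)
    (Or.inr (by decide +kernel))

set_option maxHeartbeats 400000 in
/-- `D = 10601`: the even character `(·/10601)` of conductor `10601` (`10601`: prime) — Fekete–Pólya witness of order `8` along the induced modulus `10601·21 = 222621`, block certificate (digits of `120` bits, splitting depth `10`); est. `10.4` kernel-s. [cite: MontgomeryVaughan2007, §11.2.1 Exercises 7 (g), 8] -/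
theorem noRealZeroEven_fp_10601 :
    ∀ χ : DirichletCharacter ℂ 10601, χ.IsQuadratic → χ.IsPrimitive → χ.Even →
      ∀ σ : ℝ, 0 < σ → σ < 1 → χ.LFunction σ ≠ 0 :=
  good_even_of_odd_blk [10601] (by norm_num) (by decide) (by decide) 21 8 120 10 (by decide) (by decide) (by decide)
    (Or.inr (by decide +kernel))

set_option maxHeartbeats 400000 in
/-- `D = 10652`: the even character `χ₋₄·(·/2663)` of conductor `10652` (`2663`: prime) — Fekete–Pólya witness of order `5` along the induced modulus `10652·15 = 159780`, block certificate (digits of `72` bits, splitting depth `10`); est. `4.0` kernel-s. [cite: MontgomeryVaughan2007, §11.2.1 Exercises 7 (g), 8] -/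
theorem noRealZeroEven_fp_10652 :
    ∀ χ : DirichletCharacter ℂ 10652, χ.IsQuadratic → χ.IsPrimitive → χ.Even →
      ∀ σ : ℝ, 0 < σ → σ < 1 → χ.LFunction σ ≠ 0 :=
  good_even_of_four_blk [2663] (by norm_num) (by decide) (by decide) 15 5 72 10 (by decide) (by decide) (by decide)
    (Or.inr (by decide +kernel))

set_option maxHeartbeats 400000 in
/-- `D = -10723`: the odd character `(·/10723)` of conductor `10723` (`10723`: prime) — Fekete–Pólya witness of order `9` along the induced modulus `10723·10 = 107230`, block certificate (digits of `126` bits, splitting depth `9`); est. `6.1` kernel-s. [cite: MontgomeryVaughan2007, §11.2.1 Exercises 7 (g), 8] -/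
theorem noRealZeroOdd_fp_10723 :
    ∀ χ : DirichletCharacter ℂ 10723, χ.IsQuadratic → χ.IsPrimitive → χ.Odd →
      ∀ σ : ℝ, 0 < σ → σ < 1 → χ.LFunction σ ≠ 0 :=
  good_odd_of_odd_blk [10723] (by norm_num) (by decide) (by decide) 10 9 126 9 (by decide) (by decide) (by decide)
    (Or.inr (by decide +kernel))

set_option maxHeartbeats 400000 in
/-- `D = -10744`: the odd character `χ₈·(·/1343)` of conductor `10744` (`1343`: 17 · 79) — Fekete–Pólya witness of order `5` along the induced modulus `10744·13 = 139672`, block certificate (digits of `72` bits, splitting depth `10`); est. `3.4` kernel-s. [cite: MontgomeryVaughan2007, §11.2.1 Exercises 7 (g), 8] -/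
theorem noRealZeroOdd_fp_10744 :
    ∀ χ : DirichletCharacter ℂ 10744, χ.IsQuadratic → χ.IsPrimitive → χ.Odd →
      ∀ σ : ℝ, 0 < σ → σ < 1 → χ.LFunction σ ≠ 0 :=
  good_odd_of_eight_blk [17, 79] (by norm_num) (by decide) (by decide) 13 5 72 10 (by decide) (by decide) (by decide)
    (Or.inl (by decide +kernel)) (Or.inr (by decide +kernel))

end Literature.NumberTheory.LFunctions
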